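import Mathlib.RepresentationTheory.Basic
import Literature.NumberTheory.Automorphic.SmoothRepresentation
import HarnessLib

/-!
# Finite transversals of compact subgroups and the averaging projectors `e_K`

Let `G` be a topological group, `K ≤ G` a compact subgroup and `S = K ∩ T` its intersection
with an open subgroup `T`. Then `K / S` is finite and has a finite set of representatives
(`exists_isLeftTransversal`). For a representation `ρ` of `G` on a `k`-vector space `V`
(`char k = 0`) and a vector `v` with open stabiliser, the **averaging projector**
`e_K v = [K : K_v]⁻¹ ∑_{r ∈ K/K_v} ρ(r) v` (`Representation.avgProj`; Bernstein–Zelevinsky 1976,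
§2.3, the operator `π(e_K)`; Casselman 1995, §2.1) is the Haar average `∫_K ρ(κ) v dκ`
written as a finite sum; we prove that it is independent of the auxiliary open subgroup
(`avgProj_eq`), additive on smooth vectors, `K`-invariant (`apply_avgProj`,
`avgProj_apply_of_mem`), the identity on `V^K`, and that `λ ∘ e_K` is a smooth linear form for
every linear form `λ` on a smooth representation (`avgProjLinear`,
`comp_avgProjLinear_mem_contragredient`). We also
record the **easy half of Jacquet's lemma** (Bernstein–Zelevinsky 1976, 2.33; Bump 1997,
Prop. 4.4.1; Casselman 1995, §3.3): if the sum of `ρ(r) v` over a transversal of `U₀ / (U₀)_v`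
vanishes for a compact subgroup `U₀`, then `v` lies in the span of the `ρ(u) x - x`, `u ∈ U₀`
(`mem_span_of_sum_eq_zero`).

Everything is elementary (finite sums over transversals, no Haar measure), in the style of
`Literature.NumberTheory.Automorphic.TwistedJacquetAdditive` (lattices in the additive group
of a local field).

## Relation to Mathlib

Mathlib has complements/transversals of a subgroup in the *whole* group
(`Subgroup.IsComplement` and its API) and the index `Subgroup.index`, but no finite transversal
of `K / (K ∩ T)` *inside a compact subgroup `K`* of a topological group and no averaging
operators on representations; `IsLeftTransversal B S R` below is the relative, finite notion (a
`Finset` of representatives of the left cosets of `S` in `B`), whose existence is *proved* from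
compactness.

## References

* I. N. Bernstein, A. V. Zelevinsky, *Representations of the group `GL(n,F)` where `F` is a
  non-archimedean local field*, Russian Math. Surveys 31:3 (1976), §2.3, 2.33
  (`BernsteinZelevinskyRMS1976`; not held).
* W. Casselman, *Introduction to the theory of admissible representations of `p`-adic
  reductive groups* (1995), §2.1, §3.3 (`Casselman1995`).
* D. Bump, *Automorphic forms and representations* (1997), Prop. 4.4.1 (PDF p. 460) (`Bump1997`).
-/

open scoped BigOperators

namespace Literature.NumberTheory.Automorphic

/-! ### Finite left transversals of `B / S` -/

section Transversal

variable {G : Type*} [Group G]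

/-- `R` is a finite **left transversal** of the subgroup `B` modulo the subgroup `S`
(relative, finite version of Mathlib's `Subgroup.IsComplement`): `R ⊆ B` and every `x ∈ B`
lies in exactly one coset `r S`, `r ∈ R`. [folklore] -/
structure IsLeftTransversal (B S : Subgroup G) (R : Finset G) : Prop where
  /-- The representatives lie in `B`. -/
  mem_of_mem : ∀ r ∈ R, r ∈ B
  /-- Every `x ∈ B` lies in exactly one coset `r S`, `r ∈ R`. -/
  existsUnique : ∀ x ∈ B, ∃! r, r ∈ R ∧ r⁻¹ * x ∈ S

/-- **Existence of finite transversals**: for a compact subgroup `B` and an open subgroup `T`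
of a topological group, `B / (B ∩ T)` has a finite left transversal (compactness of `B` gives
finitely many cosets `x T` covering it; representatives are chosen with `Quotient.out` in
`G ⧸ (B ⊓ T)`). [folklore] -/
theorem exists_isLeftTransversal [TopologicalSpace G] [IsTopologicalGroup G] {B T : Subgroup G}
    (hB : IsCompact (B : Set G)) (hT : IsOpen (T : Set G)) :
    ∃ R : Finset G, IsLeftTransversal B (B ⊓ T) R := by
  classical
  let U : G → Set G := fun x => {y | x⁻¹ * y ∈ T}
  have hUo : ∀ x ∈ (B : Set G), IsOpen (U x) := fun x _ =>
    hT.preimage (continuous_const.mul continuous_id)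
  have hcover : (B : Set G) ⊆ ⋃ x ∈ (B : Set G), U x := fun y hy =>
    Set.mem_iUnion₂.2 ⟨y, hy, by simp [U, T.one_mem]⟩
  obtain ⟨F₀, hF₀B, hF₀fin, hF₀⟩ := hB.elim_finite_subcover_image hUo hcover
  let S : Subgroup G := B ⊓ T
  let q : G → G ⧸ S := QuotientGroup.mk
  let out : G → G := fun x => Quotient.out (q x)
  have hout : ∀ x, x⁻¹ * out x ∈ S := fun x => by
    have h1 : q (out x) = q x := Quotient.out_eq _
    exact QuotientGroup.eq.1 h1.symm
  refine ⟨hF₀fin.toFinset.image out, ⟨fun r hr => ?_, fun x hx => ?_⟩⟩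
  · obtain ⟨x, hx, rfl⟩ := Finset.mem_image.1 hr
    have hxB : x ∈ B := hF₀B (hF₀fin.mem_toFinset.1 hx)
    have : out x = x * (x⁻¹ * out x) := by group
    rw [this]
    exact B.mul_mem hxB (hout x).1
  · obtain ⟨x₀, hx₀F, hx₀⟩ : ∃ x₀ ∈ F₀, x ∈ U x₀ := by
      have := hF₀ hx
      simpa only [Set.mem_iUnion, exists_prop] using this
    have hx₀T : x₀⁻¹ * x ∈ T := hx₀
    have hx₀B : x₀ ∈ B := hF₀B hx₀F
    have hx₀S : x₀⁻¹ * x ∈ S := ⟨B.mul_mem (B.inv_mem hx₀B) hx, hx₀T⟩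
    refine ⟨out x₀, ⟨Finset.mem_image.2 ⟨x₀, hF₀fin.mem_toFinset.2 hx₀F, rfl⟩, ?_⟩, ?_⟩
    · have : (out x₀)⁻¹ * x = (x₀⁻¹ * out x₀)⁻¹ * (x₀⁻¹ * x) := by group
      rw [this]
      exact S.mul_mem (S.inv_mem (hout x₀)) hx₀S
    · rintro r ⟨hr, hxr⟩
      obtain ⟨x₁, -, rfl⟩ := Finset.mem_image.1 hr
      have h1 : q x₁ = q x₀ := by
        have e1 : q (out x₁) = q x₁ := Quotient.out_eq _
        have e0 : q x₀ = q x := QuotientGroup.eq.2 hx₀S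
        have e2 : q (out x₁) = q x := QuotientGroup.eq.2 hxr
        rw [← e1, e2, ← e0]
      change Quotient.out (q x₁) = Quotient.out (q x₀)
      rw [h1]

namespace IsLeftTransversal

variable {B S : Subgroup G} {R : Finset G}

/-- The representative in `R` of the coset of `x ∈ B` (and `1` off `B`). [folklore] -/
noncomputable def rep (h : IsLeftTransversal B S R) (x : G) : G :=
  by classical exact if hx : x ∈ B then Classical.choose (h.existsUnique x hx).exists else 1

/-- Defining property of `rep`. [folklore] -/
lemma rep_spec (h : IsLeftTransversal B S R) {x : G} (hx : x ∈ B) :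
    h.rep x ∈ R ∧ (h.rep x)⁻¹ * x ∈ S := by
  classical
  simp only [rep, dif_pos hx]
  exact Classical.choose_spec (h.existsUnique x hx).exists

/-- The representative lies in `R`. [folklore] -/
lemma rep_mem (h : IsLeftTransversal B S R) {x : G} (hx : x ∈ B) : h.rep x ∈ R := (h.rep_spec hx).1

/-- `(rep x)⁻¹ x ∈ S`. [folklore] -/
lemma rep_inv_mul_mem (h : IsLeftTransversal B S R) {x : G} (hx : x ∈ B) : (h.rep x)⁻¹ * x ∈ S :=
  (h.rep_spec hx).2

/-- The representative lies in `B`. [folklore] -/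
lemma rep_mem_B (h : IsLeftTransversal B S R) {x : G} (hx : x ∈ B) : h.rep x ∈ B :=
  h.mem_of_mem _ (h.rep_mem hx)

/-- Uniqueness of representatives. [folklore] -/
lemma rep_eq_of (h : IsLeftTransversal B S R) {x r : G} (hx : x ∈ B) (hr : r ∈ R)
    (hxr : r⁻¹ * x ∈ S) : h.rep x = r :=
  (h.existsUnique x hx).unique (h.rep_spec hx) ⟨hr, hxr⟩

/-- Elements of `R` are their own representatives. [folklore] -/
lemma rep_self (h : IsLeftTransversal B S R) {r : G} (hr : r ∈ R) : h.rep r = r :=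
  h.rep_eq_of (h.mem_of_mem r hr) hr (by simp [S.one_mem])

/-- A transversal of a (non-empty) subgroup is non-empty. [folklore] -/
lemma nonempty (h : IsLeftTransversal B S R) : R.Nonempty := ⟨h.rep 1, h.rep_mem B.one_mem⟩

/-- The representative of `1` lies in `S`. [folklore] -/
lemma rep_one_mem (h : IsLeftTransversal B S R) : h.rep 1 ∈ S := by
  have := h.rep_inv_mul_mem B.one_mem
  rw [mul_one] at this
  have h' := S.inv_mem this
  rwa [inv_inv] at h'

/-- An element of `R` lying in `S` is `rep 1`. [folklore] -/
lemma eq_rep_one_of_mem (h : IsLeftTransversal B S R) {r : G} (hr : r ∈ R) (hrS : r ∈ S) :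
    r = h.rep 1 :=
  (h.rep_eq_of B.one_mem hr (by simpa using S.inv_mem hrS)).symm

/-! ### Sums over transversals -/

variable {M : Type*} [AddCommMonoid M]

/-- **Left translation invariance**: for a right-`S`-invariant `f` on `B` and `x₀ ∈ B`,
`∑_{r ∈ R} f (x₀ r) = ∑_{r ∈ R} f r`. [folklore] -/
theorem sum_mul_left (h : IsLeftTransversal B S R) (f : G → M)
    (hf : ∀ x ∈ B, ∀ s ∈ S, f (x * s) = f x) {x₀ : G} (hx₀ : x₀ ∈ B) :
    ∑ r ∈ R, f (x₀ * r) = ∑ r ∈ R, f r := by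
  refine Finset.sum_nbij' (fun r => h.rep (x₀ * r)) (fun r => h.rep (x₀⁻¹ * r)) ?_ ?_ ?_ ?_ ?_
  · exact fun r hr => h.rep_mem (B.mul_mem hx₀ (h.mem_of_mem r hr))
  · exact fun r hr => h.rep_mem (B.mul_mem (B.inv_mem hx₀) (h.mem_of_mem r hr))
  · intro r hr
    have hrB := h.mem_of_mem r hr
    have h1 : x₀ * r ∈ B := B.mul_mem hx₀ hrB
    refine h.rep_eq_of (B.mul_mem (B.inv_mem hx₀) (h.rep_mem_B h1)) hr ?_
    have : r⁻¹ * (x₀⁻¹ * h.rep (x₀ * r)) = ((h.rep (x₀ * r))⁻¹ * (x₀ * r))⁻¹ := by group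
    rw [this]
    exact S.inv_mem (h.rep_inv_mul_mem h1)
  · intro r hr
    have hrB := h.mem_of_mem r hr
    have h1 : x₀⁻¹ * r ∈ B := B.mul_mem (B.inv_mem hx₀) hrB
    refine h.rep_eq_of (B.mul_mem hx₀ (h.rep_mem_B h1)) hr ?_
    have : r⁻¹ * (x₀ * h.rep (x₀⁻¹ * r)) = ((h.rep (x₀⁻¹ * r))⁻¹ * (x₀⁻¹ * r))⁻¹ := by group
    rw [this]
    exact S.inv_mem (h.rep_inv_mul_mem h1)
  · intro r hr
    have h1 : x₀ * r ∈ B := B.mul_mem hx₀ (h.mem_of_mem r hr)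
    have : x₀ * r = h.rep (x₀ * r) * ((h.rep (x₀ * r))⁻¹ * (x₀ * r)) := by group
    conv_lhs => rw [this]
    exact hf _ (h.rep_mem_B h1) _ (h.rep_inv_mul_mem h1)

/-- **Two transversals give the same sum** of a right-`S`-invariant function. [folklore] -/
theorem sum_eq_sum_of_isLeftTransversal (h : IsLeftTransversal B S R) {R' : Finset G}
    (h' : IsLeftTransversal B S R') (f : G → M) (hf : ∀ x ∈ B, ∀ s ∈ S, f (x * s) = f x) :
    ∑ r ∈ R, f r = ∑ r ∈ R', f r := by
  refine Finset.sum_nbij' (fun r => h'.rep r) (fun r => h.rep r) ?_ ?_ ?_ ?_ ?_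
  · exact fun r hr => h'.rep_mem (h.mem_of_mem r hr)
  · exact fun r hr => h.rep_mem (h'.mem_of_mem r hr)
  · intro r hr
    have hrB := h.mem_of_mem r hr
    refine h.rep_eq_of (h'.rep_mem_B hrB) hr ?_
    have : r⁻¹ * h'.rep r = ((h'.rep r)⁻¹ * r)⁻¹ := by group
    rw [this]; exact S.inv_mem (h'.rep_inv_mul_mem hrB)
  · intro r hr
    have hrB := h'.mem_of_mem r hr
    refine h'.rep_eq_of (h.rep_mem_B hrB) hr ?_
    have : r⁻¹ * h.rep r = ((h.rep r)⁻¹ * r)⁻¹ := by group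
    rw [this]; exact S.inv_mem (h.rep_inv_mul_mem hrB)
  · intro r hr
    have hrB := h.mem_of_mem r hr
    have : r = h'.rep r * ((h'.rep r)⁻¹ * r) := by group
    conv_lhs => rw [this]
    exact hf _ (h'.rep_mem_B hrB) _ (h'.rep_inv_mul_mem hrB)

/-- **Summation in stages**: for `S ≤ B' ≤ B`, transversals `R` of `B/S`, `R'` of `B/B'` and
`R''` of `B'/S`, and a right-`S`-invariant `f`,
`∑_{r ∈ R} f r = ∑_{r' ∈ R'} ∑_{r'' ∈ R''} f (r' r'')`. [folklore] -/
theorem sum_eq_sum_sum {B' : Subgroup G} {R' R'' : Finset G} (h : IsLeftTransversal B S R)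
    (h' : IsLeftTransversal B B' R') (h'' : IsLeftTransversal B' S R'') (hB'B : B' ≤ B)
    (hSB' : S ≤ B') (f : G → M) (hf : ∀ x ∈ B, ∀ s ∈ S, f (x * s) = f x) :
    ∑ r ∈ R, f r = ∑ r' ∈ R', ∑ r'' ∈ R'', f (r' * r'') := by
  rw [← Finset.sum_product']
  symm
  refine Finset.sum_nbij' (fun p => h.rep (p.1 * p.2))
    (fun r => (h'.rep r, h''.rep ((h'.rep r)⁻¹ * r))) ?_ ?_ ?_ ?_ ?_
  · rintro ⟨p₁, p₂⟩ hp
    rw [Finset.mem_product] at hp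
    exact h.rep_mem (B.mul_mem (h'.mem_of_mem _ hp.1) (hB'B (h''.mem_of_mem _ hp.2)))
  · intro r hr
    have hrB := h.mem_of_mem r hr
    rw [Finset.mem_product]
    exact ⟨h'.rep_mem hrB, h''.rep_mem (h'.rep_inv_mul_mem hrB)⟩
  · rintro ⟨p₁, p₂⟩ hp
    rw [Finset.mem_product] at hp
    have hp₁B := h'.mem_of_mem _ hp.1
    have hp₂B' := h''.mem_of_mem _ hp.2
    have hprod : p₁ * p₂ ∈ B := B.mul_mem hp₁B (hB'B hp₂B')
    set r := h.rep (p₁ * p₂) with hr_def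
    have hs : r⁻¹ * (p₁ * p₂) ∈ S := h.rep_inv_mul_mem hprod
    have hrB : r ∈ B := h.rep_mem_B hprod
    have e1 : h'.rep r = p₁ := by
      refine h'.rep_eq_of hrB hp.1 ?_
      have : p₁⁻¹ * r = p₂ * (r⁻¹ * (p₁ * p₂))⁻¹ := by group
      rw [this]
      exact B'.mul_mem hp₂B' (B'.inv_mem (hSB' hs))
    have e2 : h''.rep ((h'.rep r)⁻¹ * r) = p₂ := by
      rw [e1]
      have hmem : p₁⁻¹ * r ∈ B' := by
        have : p₁⁻¹ * r = p₂ * (r⁻¹ * (p₁ * p₂))⁻¹ := by group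
        rw [this]; exact B'.mul_mem hp₂B' (B'.inv_mem (hSB' hs))
      refine h''.rep_eq_of hmem hp.2 ?_
      have : p₂⁻¹ * (p₁⁻¹ * r) = (r⁻¹ * (p₁ * p₂))⁻¹ := by group
      rw [this]; exact S.inv_mem hs
    exact Prod.ext e1 e2
  · intro r hr
    have hrB := h.mem_of_mem r hr
    have h1 : (h'.rep r)⁻¹ * r ∈ B' := h'.rep_inv_mul_mem hrB
    have h2 : (h''.rep ((h'.rep r)⁻¹ * r))⁻¹ * ((h'.rep r)⁻¹ * r) ∈ S := h''.rep_inv_mul_mem h1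
    change h.rep (h'.rep r * h''.rep ((h'.rep r)⁻¹ * r)) = r
    refine h.rep_eq_of (B.mul_mem (h'.rep_mem_B hrB) (hB'B (h''.rep_mem_B h1))) hr ?_
    have : r⁻¹ * (h'.rep r * h''.rep ((h'.rep r)⁻¹ * r)) =
        ((h''.rep ((h'.rep r)⁻¹ * r))⁻¹ * ((h'.rep r)⁻¹ * r))⁻¹ := by group
    rw [this]; exact S.inv_mem h2
  · rintro ⟨p₁, p₂⟩ hp
    rw [Finset.mem_product] at hp
    have hprod : p₁ * p₂ ∈ B := B.mul_mem (h'.mem_of_mem _ hp.1) (hB'B (h''.mem_of_mem _ hp.2))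
    change f (p₁ * p₂) = f (h.rep (p₁ * p₂))
    have : p₁ * p₂ = h.rep (p₁ * p₂) * ((h.rep (p₁ * p₂))⁻¹ * (p₁ * p₂)) := by group
    conv_lhs => rw [this]
    exact hf _ (h.rep_mem_B hprod) _ (h.rep_inv_mul_mem hprod)

/-- The sum of a `B'`-invariant family over a transversal of `B'/S` is a multiple of one term.
[folklore] -/
theorem sum_eq_card_smul (R : Finset G) (f : G → M) (x : G)
    (hf : ∀ r ∈ R, f (x * r) = f x) : ∑ r ∈ R, f (x * r) = R.card • f x := by
  rw [Finset.sum_congr rfl hf, Finset.sum_const]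

/-- **Right translation of a transversal**: if `R` is a left transversal of `B` modulo the
conjugate `κ S κ⁻¹ ∩ B`-type subgroup `S'` (`x ∈ S' ↔ κ⁻¹ x κ ∈ S`), `κ ∈ B`, then `R κ` is a
left transversal of `B` modulo `S`. [folklore] -/
theorem image_mul_right [DecidableEq G] {S' : Subgroup G} (h : IsLeftTransversal B S' R) {κ : G}
    (hκ : κ ∈ B) (hS' : ∀ x, x ∈ S' ↔ κ⁻¹ * x * κ ∈ S) :
    IsLeftTransversal B S (R.image fun r => r * κ) := by
  refine ⟨fun y hy => ?_, fun x hx => ?_⟩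
  · obtain ⟨r, hr, rfl⟩ := Finset.mem_image.1 hy
    exact B.mul_mem (h.mem_of_mem r hr) hκ
  · have hxκ : x * κ⁻¹ ∈ B := B.mul_mem hx (B.inv_mem hκ)
    obtain ⟨r, ⟨hr, hrx⟩, huniq⟩ := h.existsUnique (x * κ⁻¹) hxκ
    refine ⟨r * κ, ⟨Finset.mem_image.2 ⟨r, hr, rfl⟩, ?_⟩, ?_⟩
    · have := (hS' _).1 hrx
      have e : κ⁻¹ * (r⁻¹ * (x * κ⁻¹)) * κ = (r * κ)⁻¹ * x := by group
      rwa [e] at this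
    · rintro y ⟨hy, hyx⟩
      obtain ⟨r', hr', rfl⟩ := Finset.mem_image.1 hy
      have : r' = r := by
        refine huniq r' ⟨hr', (hS' _).2 ?_⟩
        have e : κ⁻¹ * (r'⁻¹ * (x * κ⁻¹)) * κ = (r' * κ)⁻¹ * x := by group
        rwa [e]
      rw [this]

/-- **Conjugating a transversal**: if `R` is a left transversal of `B` modulo `S` then
`g R g⁻¹` is a left transversal of `B'` modulo `S'` whenever `x ∈ B' ↔ g⁻¹ x g ∈ B` and
`x ∈ S' ↔ g⁻¹ x g ∈ S`. [folklore] -/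
theorem image_conj [DecidableEq G] (h : IsLeftTransversal B S R) (g : G) {B' S' : Subgroup G}
    (hB' : ∀ x, x ∈ B' ↔ g⁻¹ * x * g ∈ B) (hS' : ∀ x, x ∈ S' ↔ g⁻¹ * x * g ∈ S) :
    IsLeftTransversal B' S' (R.image fun r => g * r * g⁻¹) := by
  refine ⟨fun y hy => ?_, fun x hx => ?_⟩
  · obtain ⟨r, hr, rfl⟩ := Finset.mem_image.1 hy
    rw [hB']
    have e : g⁻¹ * (g * r * g⁻¹) * g = r := by group
    rw [e]; exact h.mem_of_mem r hr
  · have hx' : g⁻¹ * x * g ∈ B := (hB' x).1 hx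
    obtain ⟨r, ⟨hr, hrx⟩, huniq⟩ := h.existsUnique _ hx'
    refine ⟨g * r * g⁻¹, ⟨Finset.mem_image.2 ⟨r, hr, rfl⟩, ?_⟩, ?_⟩
    · rw [hS']
      have e : g⁻¹ * ((g * r * g⁻¹)⁻¹ * x) * g = r⁻¹ * (g⁻¹ * x * g) := by group
      rw [e]; exact hrx
    · rintro y ⟨hy, hyx⟩
      obtain ⟨r', hr', rfl⟩ := Finset.mem_image.1 hy
      have : r' = r := by
        refine huniq r' ⟨hr', ?_⟩
        have := (hS' _).1 hyx
        have e : g⁻¹ * ((g * r' * g⁻¹)⁻¹ * x) * g = r'⁻¹ * (g⁻¹ * x * g) := by group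
        rwa [e] at this
      rw [this]

end IsLeftTransversal

end Transversal

end Literature.NumberTheory.Automorphic

/-! ### The averaging projector `e_K` on a representation -/

namespace Representation

open Literature.NumberTheory.Automorphic

section JacquetEasy

variable {k G V : Type*} [Field k] [CharZero k] [Group G] [AddCommGroup V] [Module k V]
  (ρ : Representation k G V)

/-- **The easy half of Jacquet's lemma** (Bernstein–Zelevinsky 1976, 2.33; Bump 1997,
Prop. 4.4.1; Casselman 1995, §3.3): if the sum of `ρ(r) v` over a left transversal `R` of a
subgroup `U₀` modulo a subgroup fixing `v` vanishes, then `v` lies in the span of the vectors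
`ρ(u) x - x`, `u ∈ U₀`: indeed `v = #R⁻¹ ∑_{r ∈ R} (v - ρ(r) v)`. [cite: Bump1997, Proposition 4.4.1 (PDF p. 460)] -/
theorem mem_span_of_sum_eq_zero {U₀ S : Subgroup G} {R : Finset G} (hR : IsLeftTransversal U₀ S R)
    {v : V} (hsum : ∑ r ∈ R, ρ r v = 0) :
    v ∈ Submodule.span k {w | ∃ u ∈ (U₀ : Set G), ∃ x : V, w = ρ u x - x} := by
  have hcard : (R.card : k) ≠ 0 := Nat.cast_ne_zero.2 (Finset.card_ne_zero.2 hR.nonempty)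
  have key : (R.card : k) • v = ∑ r ∈ R, (v - ρ r v) := by
    rw [Finset.sum_sub_distrib, hsum, sub_zero, Finset.sum_const, Nat.cast_smul_eq_nsmul]
  have hv : v = (R.card : k)⁻¹ • ∑ r ∈ R, (v - ρ r v) := by
    rw [← key, smul_smul, inv_mul_cancel₀ hcard, one_smul]
  rw [hv]
  refine Submodule.smul_mem _ _ (Submodule.sum_mem _ fun r hr => ?_)
  have : v - ρ r v = -(ρ r v - v) := by abel
  rw [this]
  exact Submodule.neg_mem _ (Submodule.subset_span ⟨r, hR.mem_of_mem r hr, v, rfl⟩)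

end JacquetEasy

section Averaging

variable {k G V : Type*} [Field k] [CharZero k] [Group G] [TopologicalSpace G] [IsTopologicalGroup G]
  [AddCommGroup V] [Module k V] (ρ : Representation k G V) (K : Subgroup G)

/-- The **averaging projector** `e_K v = [K : K ∩ G_v]⁻¹ ∑_{r ∈ K/(K ∩ G_v)} ρ(r) v` of a
compact subgroup `K` on a vector `v` with open stabiliser `G_v` (and `0` if the stabiliser
is not open or `K` is not compact): the Haar average `∫_K ρ(κ) v dκ`, i.e. the action of the
idempotent `e_K` of the Hecke algebra (Bernstein–Zelevinsky 1976, §2.3; Casselman 1995, §2.1),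
as a finite sum over a chosen transversal. [cite: Casselman1995, §2.1] -/
noncomputable def avgProj (v : V) : V :=
  by classical exact
  if h : IsCompact (K : Set G) ∧ IsOpen (ρ.stabilizerSubgroup v : Set G) then
    ((Classical.choose (exists_isLeftTransversal h.1 h.2)).card : k)⁻¹ •
      ∑ r ∈ Classical.choose (exists_isLeftTransversal h.1 h.2), ρ r v
  else 0

variable {ρ K}

/-- The sum of `ρ(r) v` over a left transversal of `K / (K ∩ T)` does not depend on the open
subgroup `T` fixing `v` nor on the transversal, after normalisation: comparison through the
common refinement `T ∩ T'`. [folklore] -/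
theorem card_inv_smul_sum_eq (hK : IsCompact (K : Set G)) {T T' : Subgroup G}
    (hT : IsOpen (T : Set G)) (hT' : IsOpen (T' : Set G)) {v : V}
    (hTv : ∀ t ∈ T, ρ t v = v) (hT'v : ∀ t ∈ T', ρ t v = v)
    {R R' : Finset G} (hR : IsLeftTransversal K (K ⊓ T) R) (hR' : IsLeftTransversal K (K ⊓ T') R') :
    (R.card : k)⁻¹ • ∑ r ∈ R, ρ r v = (R'.card : k)⁻¹ • ∑ r ∈ R', ρ r v := by
  -- the common refinement
  have hTT' : IsOpen ((T ⊓ T' : Subgroup G) : Set G) := hT.inter hT'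
  obtain ⟨R₀, hR₀⟩ := exists_isLeftTransversal (B := K) hK hTT'
  -- transversals of `(K ⊓ T) / (K ⊓ T ⊓ T')` and `(K ⊓ T') / (K ⊓ T ⊓ T')`
  have hKT : IsCompact ((K ⊓ T : Subgroup G) : Set G) := by
    have : ((K ⊓ T : Subgroup G) : Set G) = (K : Set G) ∩ T := rfl
    rw [this]
    exact hK.inter_right (T.isClosed_of_isOpen hT)
  have hKT' : IsCompact ((K ⊓ T' : Subgroup G) : Set G) := by
    have : ((K ⊓ T' : Subgroup G) : Set G) = (K : Set G) ∩ T' := rfl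
    rw [this]
    exact hK.inter_right (T'.isClosed_of_isOpen hT')
  obtain ⟨R₁, hR₁⟩ := exists_isLeftTransversal (B := K ⊓ T) hKT hT'
  obtain ⟨R₂, hR₂⟩ := exists_isLeftTransversal (B := K ⊓ T') hKT' hT
  have e1 : (K ⊓ T) ⊓ T' = K ⊓ (T ⊓ T') := inf_assoc K T T'
  have e2 : (K ⊓ T') ⊓ T = K ⊓ (T ⊓ T') := by
    rw [inf_assoc, inf_comm T' T]
  rw [e1] at hR₁
  rw [e2] at hR₂
  let f : G → V := fun g => ρ g v
  have hf : ∀ x ∈ K, ∀ s ∈ K ⊓ (T ⊓ T'), f (x * s) = f x := fun x _ s hs => by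
    simp only [f, map_mul, Module.End.mul_apply, hTv s hs.2.1]
  have h1 : ∑ r ∈ R₀, f r = ∑ r ∈ R, ∑ r₁ ∈ R₁, f (r * r₁) :=
    hR₀.sum_eq_sum_sum hR hR₁ inf_le_left (le_inf inf_le_left (inf_le_right.trans inf_le_left)) f hf
  have h2 : ∑ r ∈ R₀, f r = ∑ r ∈ R', ∑ r₂ ∈ R₂, f (r * r₂) :=
    hR₀.sum_eq_sum_sum hR' hR₂ inf_le_left (le_inf inf_le_left (inf_le_right.trans inf_le_right)) f hf
  have h1' : ∀ r ∈ R, ∑ r₁ ∈ R₁, f (r * r₁) = R₁.card • f r := fun r _ =>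
    IsLeftTransversal.sum_eq_card_smul R₁ f r fun r₁ hr₁ => by
      simp only [f, map_mul, Module.End.mul_apply, hTv r₁ (hR₁.mem_of_mem r₁ hr₁).2]
  have h2' : ∀ r ∈ R', ∑ r₂ ∈ R₂, f (r * r₂) = R₂.card • f r := fun r _ =>
    IsLeftTransversal.sum_eq_card_smul R₂ f r fun r₂ hr₂ => by
      simp only [f, map_mul, Module.End.mul_apply, hT'v r₂ (hR₂.mem_of_mem r₂ hr₂).2]
  rw [Finset.sum_congr rfl h1', ← Finset.smul_sum] at h1
  rw [Finset.sum_congr rfl h2', ← Finset.smul_sum] at h2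
  -- card bookkeeping: `#R₀ = #R · #R₁ = #R' · #R₂`
  have hc1 : R₀.card = R.card * R₁.card := by
    have := hR₀.sum_eq_sum_sum hR hR₁ inf_le_left
      (le_inf inf_le_left (inf_le_right.trans inf_le_left)) (fun _ => (1 : ℕ)) (fun _ _ _ _ => rfl)
    simpa [Finset.sum_const, Finset.card_univ] using this
  have hc2 : R₀.card = R'.card * R₂.card := by
    have := hR₀.sum_eq_sum_sum hR' hR₂ inf_le_left
      (le_inf inf_le_left (inf_le_right.trans inf_le_right)) (fun _ => (1 : ℕ)) (fun _ _ _ _ => rfl)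
    simpa [Finset.sum_const, Finset.card_univ] using this
  have hR₁0 : (R₁.card : k) ≠ 0 := Nat.cast_ne_zero.2 (Finset.card_ne_zero.2 hR₁.nonempty)
  have hR₂0 : (R₂.card : k) ≠ 0 := Nat.cast_ne_zero.2 (Finset.card_ne_zero.2 hR₂.nonempty)
  have hR0 : (R.card : k) ≠ 0 := Nat.cast_ne_zero.2 (Finset.card_ne_zero.2 hR.nonempty)
  have hR'0 : (R'.card : k) ≠ 0 := Nat.cast_ne_zero.2 (Finset.card_ne_zero.2 hR'.nonempty)
  -- `∑_R f = #R₁⁻¹ ∑_{R₀} f` and similarly for `R'`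
  have k1 : ∑ r ∈ R, f r = (R₁.card : k)⁻¹ • ∑ r ∈ R₀, f r := by
    rw [h1, ← Nat.cast_smul_eq_nsmul k, smul_smul, inv_mul_cancel₀ hR₁0, one_smul]
  have k2 : ∑ r ∈ R', f r = (R₂.card : k)⁻¹ • ∑ r ∈ R₀, f r := by
    rw [h2, ← Nat.cast_smul_eq_nsmul k, smul_smul, inv_mul_cancel₀ hR₂0, one_smul]
  change (R.card : k)⁻¹ • ∑ r ∈ R, f r = (R'.card : k)⁻¹ • ∑ r ∈ R', f r
  rw [k1, k2, smul_smul, smul_smul, ← mul_inv, ← mul_inv, ← Nat.cast_mul, ← Nat.cast_mul, ← hc1,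
    ← hc2]

/-- **`e_K v` computed with any open subgroup fixing `v`**: if `T` is an open subgroup fixing
`v` and `R` a left transversal of `K / (K ∩ T)`, then `e_K v = #R⁻¹ ∑_{r ∈ R} ρ(r) v`. [folklore] -/
theorem avgProj_eq (hK : IsCompact (K : Set G)) {T : Subgroup G} (hT : IsOpen (T : Set G)) {v : V}
    (hTv : ∀ t ∈ T, ρ t v = v) {R : Finset G} (hR : IsLeftTransversal K (K ⊓ T) R) :
    ρ.avgProj K v = (R.card : k)⁻¹ • ∑ r ∈ R, ρ r v := by
  classical
  have hv : IsOpen (ρ.stabilizerSubgroup v : Set G) :=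
    Subgroup.isOpen_mono (H₁ := T) (fun t ht => (ρ.mem_stabilizerSubgroup v t).2 (hTv t ht)) hT
  have h : IsCompact (K : Set G) ∧ IsOpen (ρ.stabilizerSubgroup v : Set G) := ⟨hK, hv⟩
  unfold avgProj
  rw [dif_pos h]
  exact card_inv_smul_sum_eq hK hv hT (fun t ht => (ρ.mem_stabilizerSubgroup v t).1 ht) hTv
    (Classical.choose_spec (exists_isLeftTransversal h.1 h.2)) hR

/-- `e_K v` is fixed by `K` (for `v` with open stabiliser). [folklore] -/
theorem apply_avgProj (hK : IsCompact (K : Set G)) {v : V} (hv : ρ.IsSmoothVector v) {κ : G}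
    (hκ : κ ∈ K) : ρ κ (ρ.avgProj K v) = ρ.avgProj K v := by
  obtain ⟨R, hR⟩ := exists_isLeftTransversal (B := K) hK hv
  have hfix : ∀ t ∈ ρ.stabilizerSubgroup v, ρ t v = v := fun t ht => (ρ.mem_stabilizerSubgroup v t).1 ht
  rw [avgProj_eq hK hv hfix hR, map_smul, map_sum]
  congr 1
  have := hR.sum_mul_left (fun g => ρ g v) (fun x _ s hs => by
    rw [map_mul, Module.End.mul_apply, hfix s hs.2]) hκ
  simpa only [map_mul, Module.End.mul_apply] using this

/-- `e_K` is the identity on `V^K`. [folklore] -/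
theorem avgProj_of_forall_apply_eq (hK : IsCompact (K : Set G)) (hKo : IsOpen (K : Set G)) {v : V}
    (hv : ∀ κ ∈ K, ρ κ v = v) : ρ.avgProj K v = v := by
  obtain ⟨R, hR⟩ := exists_isLeftTransversal (B := K) (T := K) hK hKo
  rw [avgProj_eq hK hKo hv hR]
  have : ∑ r ∈ R, ρ r v = R.card • v := by
    rw [← Finset.sum_const]
    exact Finset.sum_congr rfl fun r hr => hv r (hR.mem_of_mem r hr)
  rw [this, ← Nat.cast_smul_eq_nsmul k, smul_smul,
    inv_mul_cancel₀ (Nat.cast_ne_zero.2 (Finset.card_ne_zero.2 hR.nonempty)), one_smul]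

/-- `e_K (v + w) = e_K v + e_K w` for smooth `v, w`. [folklore] -/
theorem avgProj_add (hK : IsCompact (K : Set G)) {v w : V} (hv : ρ.IsSmoothVector v)
    (hw : ρ.IsSmoothVector w) : ρ.avgProj K (v + w) = ρ.avgProj K v + ρ.avgProj K w := by
  let T : Subgroup G := ρ.stabilizerSubgroup v ⊓ ρ.stabilizerSubgroup w
  have hT : IsOpen (T : Set G) := hv.inter hw
  obtain ⟨R, hR⟩ := exists_isLeftTransversal (B := K) hK hT
  have hTv : ∀ t ∈ T, ρ t v = v := fun t ht => (ρ.mem_stabilizerSubgroup v t).1 ht.1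
  have hTw : ∀ t ∈ T, ρ t w = w := fun t ht => (ρ.mem_stabilizerSubgroup w t).1 ht.2
  have hTvw : ∀ t ∈ T, ρ t (v + w) = v + w := fun t ht => by rw [map_add, hTv t ht, hTw t ht]
  rw [avgProj_eq hK hT hTv hR, avgProj_eq hK hT hTw hR, avgProj_eq hK hT hTvw hR, ← smul_add,
    ← Finset.sum_add_distrib]
  simp only [map_add]

/-- `e_K (c • v) = c • e_K v` for smooth `v`. [folklore] -/
theorem avgProj_smul (hK : IsCompact (K : Set G)) (c : k) {v : V} (hv : ρ.IsSmoothVector v) :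
    ρ.avgProj K (c • v) = c • ρ.avgProj K v := by
  have hT := hv
  obtain ⟨R, hR⟩ := exists_isLeftTransversal (B := K) hK hT
  have hTv : ∀ t ∈ ρ.stabilizerSubgroup v, ρ t v = v := fun t ht => (ρ.mem_stabilizerSubgroup v t).1 ht
  have hTcv : ∀ t ∈ ρ.stabilizerSubgroup v, ρ t (c • v) = c • v := fun t ht => by
    rw [map_smul, hTv t ht]
  rw [avgProj_eq hK hT hTv hR, avgProj_eq hK hT hTcv hR, smul_comm c ((R.card : k)⁻¹)]
  congr 1
  rw [Finset.smul_sum]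
  simp only [map_smul]

/-- `e_K (ρ(κ) v) = e_K v` for `κ ∈ K` and smooth `v` (right translation of the transversal).
[folklore] -/
theorem avgProj_apply_of_mem (hK : IsCompact (K : Set G)) {v : V} (hv : ρ.IsSmoothVector v) {κ : G}
    (hκ : κ ∈ K) : ρ.avgProj K (ρ κ v) = ρ.avgProj K v := by
  classical
  -- stabiliser of `ρ κ v` is the conjugate of that of `v`
  have hv' : ρ.IsSmoothVector (ρ κ v) := Representation.IsSmoothVector.apply ρ κ hv
  obtain ⟨R, hR⟩ := exists_isLeftTransversal (B := K) hK hv'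
  have hstab : ∀ x, x ∈ ρ.stabilizerSubgroup (ρ κ v) ↔ κ⁻¹ * x * κ ∈ ρ.stabilizerSubgroup v := by
    intro x
    rw [← SetLike.mem_coe, Representation.coe_stabilizerSubgroup_apply, Set.mem_preimage,
      SetLike.mem_coe]
  have hS' : ∀ x, x ∈ K ⊓ ρ.stabilizerSubgroup (ρ κ v) ↔
      κ⁻¹ * x * κ ∈ K ⊓ ρ.stabilizerSubgroup v := by
    intro x
    rw [Subgroup.mem_inf, Subgroup.mem_inf, hstab]
    refine and_congr_left fun _ =>
      ⟨fun hx => K.mul_mem (K.mul_mem (K.inv_mem hκ) hx) hκ, fun hx => ?_⟩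
    have e : x = κ * (κ⁻¹ * x * κ) * κ⁻¹ := by group
    rw [e]
    exact K.mul_mem (K.mul_mem hκ hx) (K.inv_mem hκ)
  have hR' := hR.image_mul_right hκ hS'
  have hfix : ∀ t ∈ ρ.stabilizerSubgroup v, ρ t v = v := fun t ht => (ρ.mem_stabilizerSubgroup v t).1 ht
  have hfix' : ∀ t ∈ ρ.stabilizerSubgroup (ρ κ v), ρ t (ρ κ v) = ρ κ v := fun t ht =>
    (ρ.mem_stabilizerSubgroup _ t).1 ht
  rw [avgProj_eq hK hv' hfix' hR, avgProj_eq hK hv hfix hR']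
  have hinj : Set.InjOn (fun r => r * κ) (R : Set G) := fun a _ b _ hab => mul_right_cancel hab
  rw [Finset.card_image_of_injOn hinj, Finset.sum_image hinj]
  simp only [map_mul, Module.End.mul_apply]

variable (K) in
/-- The averaging projector of a compact subgroup on a *smooth* representation, as a linear
map `e_K : V →ₗ V`. [folklore] -/
noncomputable def avgProjLinear (hρ : ρ.IsSmooth) (hK : IsCompact (K : Set G)) : V →ₗ[k] V where
  toFun := ρ.avgProj K
  map_add' v w := avgProj_add hK (hρ v) (hρ w)
  map_smul' c v := by rw [avgProj_smul hK c (hρ v), RingHom.id_apply]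

variable (K) in
/-- Unfolding lemma for `avgProjLinear`. [folklore] -/
@[simp] lemma avgProjLinear_apply (hρ : ρ.IsSmooth) (hK : IsCompact (K : Set G)) (v : V) :
    ρ.avgProjLinear K hρ hK v = ρ.avgProj K v := rfl

/-- **`λ ∘ e_K` is a smooth linear form**: for a smooth representation `ρ`, a compact open
subgroup `K` and any linear form `λ`, the form `λ ∘ e_K` is fixed by `K` under the dual action,
hence lies in the smooth contragredient (Bernstein–Zelevinsky 1976, §2.3; Casselman 1995,
§2.1: `Ṽ^K = (V^K)^*`). [folklore] -/
theorem comp_avgProjLinear_mem_contragredient (K : Subgroup G) (hρ : ρ.IsSmooth) (hK : IsCompact (K : Set G))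
    (hKo : IsOpen (K : Set G)) (l : Module.Dual k V) :
    l.comp (ρ.avgProjLinear K hρ hK) ∈ ρ.contragredient := by
  rw [Representation.mem_contragredient]
  refine Subgroup.isOpen_mono (H₁ := K) (fun κ hκ => ?_) hKo
  rw [Representation.mem_stabilizerSubgroup]
  apply LinearMap.ext
  intro v
  change l (ρ.avgProj K (ρ κ⁻¹ v)) = l (ρ.avgProj K v)
  rw [avgProj_apply_of_mem hK (hρ v) (K.inv_mem hκ)]

end Averaging

end Representation

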